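import Mathlib.MeasureTheory.Integral.Bochner.Set
import Mathlib.MeasureTheory.Function.LocallyIntegrable
import Literature.Geometry.MetricEmbeddings.HeisenbergLatticeBumpProofs
import Literature.Geometry.MetricEmbeddings.HeisenbergKoranyi
import HarnessLib

/-!
# Gradient control for the smearing `F = Σ_{g ∈ Ω} χ_g` on `ℍ(ℝ)`: the pointwise bound, the lattice
tiling by unit cells, and `∫ (|XF| + |YF|) dh ≲ |∂_h Ω|`

Family `pnp`, layer `Literature/Geometry/MetricEmbeddings` (theorems only). Source: A. Naor,
R. Young, *Vertical perimeter versus horizontal perimeter*, Ann. of Math. 188 (2018) =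
arXiv:1701.00620, §3.2 Lemma 3.6, first half of the proof (arXiv p. 23):
"`(∫_{ℍ^{2k+1}} ‖∇_ℍ Φ(h)‖^p dh)^{1/p} ≲ (Σ_{h ∈ ℍ_ℤ} Σ_{σ ∈ 𝔖_k} ‖f(hσ) − f(h)‖^p)^{1/p}` (3.7)
[…] `sup_{h ∈ gT} ‖∇_ℍΦ(h)‖^p ≲ Σ_{z ∈ 𝓑_{2m}} ‖f(gz) − f(g)‖^p` (3.9). Hence, since the assumption
on `χ` implies that `⋃_g gT = ℍ^{2k+1}`, we deduce that […] `≲ (Σ_g Σ_{z ∈ 𝓑_{2m}} ‖f(gz)−f(g)‖^p)^{1/p}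
≲ (Σ_h Σ_σ ‖f(hσ)−f(h)‖^p)^{1/p}` [by (3.5) = Lemma 3.4]", after V. Lafforgue, A. Naor,
arXiv:1212.2107 §3.3, (56)–(58) ("By integrating (56) over `yA` […] By summing (57) over `y ∈ ℍ`
and recalling (54) […]").

Here `f = 𝟙_Ω`, `p = 1`, `k = 1`, and instead of the covering `⋃ gT` we integrate over the exact
TILING of `ℍ(ℝ)` by the left translates `y·[0,1)³` of the unit cube. PROVED:

* `fderiv_smear_bound` — the POINTWISE bound: for `y` the lattice point of the cell of `u₀`,
  `|XF(u₀)| + |YF(u₀)| ≤ M Σ_{z ∈ 𝓑_{30}} |𝟙_Ω(yz) − 𝟙_Ω(y)|` (window identity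
  `Σ_W Dχ_g(u₀) = 0`, left-invariance, relevance);
* cells: `exists_cell`, `cell_unique` (the translates of `[0,1)³` tile), `mem_cell_iff`,
  `measurableSet_cell`, `measurePreserving_mulR_invR_castR` (Haar = Lebesgue, via
  `HeisK.measurePreserving_coord_mul_left`), `volume_cell` (`= 1`);
* `sum_abs_ind_sub_le_dispCount` (`Σ_{y ∈ Y} |𝟙_Ω(yz) − 𝟙_Ω(y)| ≤ dispCount Ω z`) and the
  INTEGRATED bound `integral_fderiv_smear_le`:
  `∫ (|XF| + |YF|) dh ≤ M · 30·|𝓑_{30}| · |∂_h Ω|` (counted horizontal perimeter).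

## References

* [NaorYoung2018] A. Naor, R. Young, Ann. of Math. 188 (2018) 171–279, §2, §3.1 Lemma 3.4,
  §3.2 Lemma 3.6 (arXiv:1701.00620 pp. 12–14, 20, 22–23; arXiv numbering).
-/

noncomputable section

open Finset
open scoped ContDiff

namespace Literature.Geometry.MetricEmbeddings

/-! ### The pointwise gradient bound -/

section GradientBound

open Filter _root_.Topology

/-- **Pointwise horizontal-gradient bound for `F = Σ_{g∈Ω} χ_g`** ([NY18, (3.9)] / [LN14, (56)]
for `f = 𝟙_Ω`, `p = 1`): if `y` is the lattice point of the unit cell containing `u₀`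
(`y⁻¹u₀ ∈ [0,1)³`), then
`|XF(u₀)| + |YF(u₀)| ≤ M · Σ_{z ∈ 𝓑_{30}} |𝟙_Ω(yz) − 𝟙_Ω(y)|`,
where `M` bounds `|Xχ| + |Yχ|`. Proof: `DF(u₀) = Σ_{g ∈ Ω} Dχ_g(u₀) = Σ_{g ∈ W} (𝟙_Ω(g) − 𝟙_Ω(y)) Dχ_g(u₀)`
for the window `W` around `u₀` (whose translates sum to `1` near `u₀`, so `Σ_W Dχ_g(u₀) = 0`,
and outside of which `Dχ_g(u₀) = 0`), left-invariance `Xχ_g = (Xχ)(g⁻¹·)`, and `Dχ_g(u₀) ≠ 0`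
only if `g⁻¹u₀ ∈ [0,2]³`, in which case `y⁻¹g ∈ 𝓑_{30}`. [cite: NaorYoung2018, §3.2 Lemma 3.6] -/
theorem fderiv_smear_bound (Ω : Finset (ℤ × ℤ × ℤ)) {M : ℝ}
    (hM : ∀ w : ℝ × ℝ × ℝ, |fderiv ℝ bump3 w (1, 0, 0)| + |fderiv ℝ bump3 w (0, 1, w.1)| ≤ M)
    (u₀ : ℝ × ℝ × ℝ) (y : ℤ × ℤ × ℤ)
    (hy1 : 0 ≤ u₀.1 - y.1 ∧ u₀.1 - y.1 < 1) (hy2 : 0 ≤ u₀.2.1 - y.2.1 ∧ u₀.2.1 - y.2.1 < 1)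
    (hy3 : 0 ≤ u₀.2.2 - y.2.2 - y.1 * (u₀.2.1 - y.2.1) ∧ u₀.2.2 - y.2.2 - y.1 * (u₀.2.1 - y.2.1) < 1) :
    |fderiv ℝ (smear Ω) u₀ (1, 0, 0)| + |fderiv ℝ (smear Ω) u₀ (0, 1, u₀.1)| ≤
      M * ∑ z ∈ (wordBall_finite 30).toFinset,
        |(if heisMul y z ∈ Ω then (1 : ℝ) else 0) - (if y ∈ Ω then (1 : ℝ) else 0)| := by
  classical
  -- the window
  set K : ℕ := ⌈4 * (|u₀.1| + 3)⌉₊ with hK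
  set gfun : ℕ × ℕ × ℕ → ℤ × ℤ × ℤ := fun ijk =>
    (⌊u₀.1⌋ - 2 + ijk.1, ⌊u₀.2.1⌋ - 2 + ijk.2.1, ⌊u₀.2.2⌋ - K - 3 + ijk.2.2) with hgfun
  set I : Finset (ℕ × ℕ × ℕ) := Finset.range 4 ×ˢ (Finset.range 4 ×ˢ Finset.range (2 * K + 6)) with hI
  set W : Finset (ℤ × ℤ × ℤ) := I.image gfun with hW
  -- derivatives of the translates at `u₀`
  set c : ℤ × ℤ × ℤ → (ℝ × ℝ × ℝ →L[ℝ] ℝ) := fun g => fderiv ℝ (bumpAt g) u₀ with hc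
  set ind : ℤ × ℤ × ℤ → ℝ := fun g => if g ∈ Ω then 1 else 0 with hind
  -- (A) `DF(u₀) = Σ_{g ∈ Ω} Dχ_g(u₀)`
  have hF : fderiv ℝ (smear Ω) u₀ = ∑ g ∈ Ω, c g := by
    have h : HasFDerivAt (smear Ω) (∑ g ∈ Ω, c g) u₀ := by
      unfold smear
      exact HasFDerivAt.fun_sum fun g _ => ((contDiff_bumpAt g).differentiable (by simp) _).hasFDerivAt
    exact h.fderiv
  -- (B) outside the window the derivatives vanish
  have hvan : ∀ g, g ∉ W → c g = 0 := by
    intro g hg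
    apply fderiv_eq_zero_of_eventually_eq_zero
    have o1 : IsOpen {u : ℝ × ℝ × ℝ | |u.1 - u₀.1| < 1} :=
      isOpen_lt (continuous_fst.sub continuous_const).abs continuous_const
    have o2 : IsOpen {u : ℝ × ℝ × ℝ | |u.2.1 - u₀.2.1| < 1} :=
      isOpen_lt ((continuous_fst.comp continuous_snd).sub continuous_const).abs continuous_const
    have o3 : IsOpen {u : ℝ × ℝ × ℝ | |u.2.2 - u₀.2.2| < 1} :=
      isOpen_lt ((continuous_snd.comp continuous_snd).sub continuous_const).abs continuous_const
    have hopen := o1.inter (o2.inter o3)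
    have hmem : u₀ ∈ {u : ℝ × ℝ × ℝ | |u.1 - u₀.1| < 1} ∩ ({u : ℝ × ℝ × ℝ | |u.2.1 - u₀.2.1| < 1} ∩
        {u : ℝ × ℝ × ℝ | |u.2.2 - u₀.2.2| < 1}) := by
      simp only [Set.mem_inter_iff, Set.mem_setOf_eq, sub_self, abs_zero]
      norm_num
    filter_upwards [hopen.mem_nhds hmem] with u hu
    by_contra hne
    apply hg
    obtain ⟨i, hi, j, hj, k, hk, hgeq⟩ := exists_window_index_of_bumpAt_ne_zero hu.1 hu.2.1 hu.2.2 hne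
    rw [hW, Finset.mem_image]
    exact ⟨(i, j, k), Finset.mem_product.mpr ⟨hi, Finset.mem_product.mpr ⟨hj, hk⟩⟩, hgeq.symm⟩
  -- (C) the window sum of derivatives vanishes
  have hinj : Set.InjOn gfun ↑I := by
    rintro ⟨i, j, k⟩ _ ⟨i', j', k'⟩ _ h
    simp only [hgfun, Prod.mk.injEq] at h
    obtain ⟨h1, h2, h3⟩ := h
    simp only [Prod.mk.injEq]
    refine ⟨?_, ?_, ?_⟩ <;> omega
  have hWsum : ∑ g ∈ W, c g = 0 := by
    rw [hW, Finset.sum_image hinj, hI, Finset.sum_product]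
    simp_rw [Finset.sum_product]
    exact sum_fderiv_bumpAt_window_eq_zero u₀
  -- (D) `DF(u₀) = Σ_{g ∈ W} (𝟙_Ω(g) − 𝟙_Ω(y)) • Dχ_g(u₀)`
  have hkey : fderiv ℝ (smear Ω) u₀ = ∑ g ∈ W, (ind g - ind y) • c g := by
    rw [hF]
    have h1 : ∑ g ∈ Ω, c g = ∑ g ∈ Ω ∩ W, c g := by
      symm
      refine Finset.sum_subset Finset.inter_subset_left fun g hg hg' => ?_
      apply hvan
      intro hgW
      exact hg' (Finset.mem_inter.mpr ⟨hg, hgW⟩)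
    have h2 : ∑ g ∈ W, ind g • c g = ∑ g ∈ Ω ∩ W, c g := by
      rw [Finset.inter_comm, ← Finset.filter_mem_eq_inter, Finset.sum_filter]
      refine Finset.sum_congr rfl fun g _ => ?_
      simp only [hind]
      split_ifs <;> simp
    have h3 : ∑ g ∈ W, (ind g - ind y) • c g = ∑ g ∈ W, ind g • c g - ind y • ∑ g ∈ W, c g := by
      rw [Finset.smul_sum, ← Finset.sum_sub_distrib]
      exact Finset.sum_congr rfl fun g _ => ContinuousLinearMap.ext fun v => by
        simp [sub_mul]
    rw [h1, h3, h2, hWsum, smul_zero, sub_zero]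
  -- (E) evaluate at the two horizontal directions and bound term by term
  have hterm : ∀ g : ℤ × ℤ × ℤ,
      |c g (1, 0, 0)| + |c g (0, 1, u₀.1)| ≤ M * (if mulR (invR (castR g)) u₀ ∈
        Set.Icc (0 : ℝ) 2 ×ˢ (Set.Icc (0 : ℝ) 2 ×ˢ Set.Icc (0 : ℝ) 2) then 1 else 0) := by
    intro g
    split_ifs with hrel
    · rw [mul_one]
      simp only [hc]
      rw [fderiv_bumpAt_dirX, fderiv_bumpAt_dirY]
      exact hM _
    · simp only [hc]
      rw [fderiv_bumpAt_eq_zero hrel]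
      simp
  have hM0 : 0 ≤ M := by
    have := hM (0 : ℝ × ℝ × ℝ)
    exact le_trans (by positivity) this
  have hind_abs : ∀ g, 0 ≤ |ind g - ind y| := fun g => abs_nonneg _
  have hEval : ∀ v : ℝ × ℝ × ℝ, |fderiv ℝ (smear Ω) u₀ v| ≤ ∑ g ∈ W, |ind g - ind y| * |c g v| := by
    intro v
    have e : (∑ g ∈ W, (ind g - ind y) • c g) v = ∑ g ∈ W, (ind g - ind y) * c g v := by simp
    rw [hkey, e]
    refine (Finset.abs_sum_le_sum_abs _ _).trans (le_of_eq ?_)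
    exact Finset.sum_congr rfl fun g _ => abs_mul _ _
  -- (F) reindex the relevant `g` by `z = y⁻¹ g ∈ 𝓑_{30}`
  set B := (wordBall_finite 30).toFinset with hB
  have hreindex : ∑ g ∈ W.filter (fun g => mulR (invR (castR g)) u₀ ∈
      Set.Icc (0 : ℝ) 2 ×ˢ (Set.Icc (0 : ℝ) 2 ×ˢ Set.Icc (0 : ℝ) 2)), |ind g - ind y| ≤
      ∑ z ∈ B, |ind (heisMul y z) - ind y| := by
    set S := W.filter (fun g => mulR (invR (castR g)) u₀ ∈
      Set.Icc (0 : ℝ) 2 ×ˢ (Set.Icc (0 : ℝ) 2 ×ˢ Set.Icc (0 : ℝ) 2)) with hS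
    have hφ : Set.InjOn (fun g => heisMul (heisInv y) g) ↑S :=
      fun g _ g' _ h => heisMul_right_injective (heisInv y) h
    have e1 : ∑ g ∈ S, |ind g - ind y| =
        ∑ z ∈ S.image (fun g => heisMul (heisInv y) g), |ind (heisMul y z) - ind y| := by
      rw [Finset.sum_image hφ]
      refine Finset.sum_congr rfl fun g _ => ?_
      rw [heisMul_heisInv_cancel_left]
    rw [e1]
    refine Finset.sum_le_sum_of_subset_of_nonneg ?_ (fun z _ _ => abs_nonneg _)
    intro z hz
    rw [Finset.mem_image] at hz
    obtain ⟨g, hg, rfl⟩ := hz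
    rw [hS, Finset.mem_filter] at hg
    rw [hB, Set.Finite.mem_toFinset]
    exact heisInv_mul_mem_wordBall_of_rel hy1 hy2 ⟨hy3.1, by linarith [hy3.2]⟩ hg.2
  -- assemble
  calc |fderiv ℝ (smear Ω) u₀ (1, 0, 0)| + |fderiv ℝ (smear Ω) u₀ (0, 1, u₀.1)|
      ≤ ∑ g ∈ W, |ind g - ind y| * |c g (1, 0, 0)| + ∑ g ∈ W, |ind g - ind y| * |c g (0, 1, u₀.1)| :=
        add_le_add (hEval _) (hEval _)
    _ = ∑ g ∈ W, |ind g - ind y| * (|c g (1, 0, 0)| + |c g (0, 1, u₀.1)|) := by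
        rw [← Finset.sum_add_distrib]
        exact Finset.sum_congr rfl fun g _ => by ring
    _ ≤ ∑ g ∈ W, |ind g - ind y| * (M * (if mulR (invR (castR g)) u₀ ∈
          Set.Icc (0 : ℝ) 2 ×ˢ (Set.Icc (0 : ℝ) 2 ×ˢ Set.Icc (0 : ℝ) 2) then 1 else 0)) :=
        Finset.sum_le_sum fun g _ => mul_le_mul_of_nonneg_left (hterm g) (hind_abs g)
    _ = M * ∑ g ∈ W.filter (fun g => mulR (invR (castR g)) u₀ ∈
          Set.Icc (0 : ℝ) 2 ×ˢ (Set.Icc (0 : ℝ) 2 ×ˢ Set.Icc (0 : ℝ) 2)), |ind g - ind y| := by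
        rw [Finset.sum_filter, Finset.mul_sum]
        refine Finset.sum_congr rfl fun g _ => ?_
        split_ifs <;> ring
    _ ≤ M * ∑ z ∈ B, |ind (heisMul y z) - ind y| := mul_le_mul_of_nonneg_left hreindex hM0

end GradientBound

/-! ### Cells and the integrated gradient bound -/

section Cells

open _root_.MeasureTheory _root_.MeasureTheory.Measure

/-- **The lattice point of the cell containing `u`**: every `u ∈ ℍ(ℝ)` is `y·q` with `y ∈ ℍ(ℤ)`
and `q = y⁻¹u ∈ [0,1)³` (`y = (⌊u₁⌋, ⌊u₂⌋, ⌊u₃ − ⌊u₁⌋(u₂ − ⌊u₂⌋)⌋)`): the left translates of the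
unit cube by the lattice tile `ℍ(ℝ)`. [cite: NaorYoung2018, §2] -/
theorem exists_cell (u : ℝ × ℝ × ℝ) : ∃ y : ℤ × ℤ × ℤ,
    (0 ≤ u.1 - y.1 ∧ u.1 - y.1 < 1) ∧ (0 ≤ u.2.1 - y.2.1 ∧ u.2.1 - y.2.1 < 1) ∧
      (0 ≤ u.2.2 - y.2.2 - y.1 * (u.2.1 - y.2.1) ∧ u.2.2 - y.2.2 - y.1 * (u.2.1 - y.2.1) < 1) := by
  refine ⟨(⌊u.1⌋, ⌊u.2.1⌋, ⌊u.2.2 - ⌊u.1⌋ * (u.2.1 - ⌊u.2.1⌋)⌋), ?_, ?_, ?_⟩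
  · exact ⟨by linarith [Int.floor_le u.1], by linarith [Int.lt_floor_add_one u.1]⟩
  · exact ⟨by linarith [Int.floor_le u.2.1], by linarith [Int.lt_floor_add_one u.2.1]⟩
  · dsimp only
    constructor
    · linarith [Int.floor_le (u.2.2 - ⌊u.1⌋ * (u.2.1 - ⌊u.2.1⌋))]
    · linarith [Int.lt_floor_add_one (u.2.2 - ⌊u.1⌋ * (u.2.1 - ⌊u.2.1⌋))]

/-- **Cells are disjoint**: the lattice point of the cell containing `u` is unique.
[cite: NaorYoung2018, §2] -/
theorem cell_unique {u : ℝ × ℝ × ℝ} {y y' : ℤ × ℤ × ℤ}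
    (hy1 : 0 ≤ u.1 - y.1 ∧ u.1 - y.1 < 1) (hy2 : 0 ≤ u.2.1 - y.2.1 ∧ u.2.1 - y.2.1 < 1)
    (hy3 : 0 ≤ u.2.2 - y.2.2 - y.1 * (u.2.1 - y.2.1) ∧ u.2.2 - y.2.2 - y.1 * (u.2.1 - y.2.1) < 1)
    (hy1' : 0 ≤ u.1 - y'.1 ∧ u.1 - y'.1 < 1) (hy2' : 0 ≤ u.2.1 - y'.2.1 ∧ u.2.1 - y'.2.1 < 1)
    (hy3' : 0 ≤ u.2.2 - y'.2.2 - y'.1 * (u.2.1 - y'.2.1) ∧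
      u.2.2 - y'.2.2 - y'.1 * (u.2.1 - y'.2.1) < 1) : y = y' := by
  have e1 : y.1 = y'.1 := by
    have h : ⌊u.1⌋ = y.1 := Int.floor_eq_iff.mpr ⟨by linarith [hy1.1], by linarith [hy1.2]⟩
    have h' : ⌊u.1⌋ = y'.1 := Int.floor_eq_iff.mpr ⟨by linarith [hy1'.1], by linarith [hy1'.2]⟩
    exact h.symm.trans h'
  have e2 : y.2.1 = y'.2.1 := by
    have h : ⌊u.2.1⌋ = y.2.1 := Int.floor_eq_iff.mpr ⟨by linarith [hy2.1], by linarith [hy2.2]⟩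
    have h' : ⌊u.2.1⌋ = y'.2.1 :=
      Int.floor_eq_iff.mpr ⟨by linarith [hy2'.1], by linarith [hy2'.2]⟩
    exact h.symm.trans h'
  have e3 : y.2.2 = y'.2.2 := by
    have e1r : (y.1 : ℝ) = y'.1 := by exact_mod_cast e1
    have e2r : (y.2.1 : ℝ) = y'.2.1 := by exact_mod_cast e2
    rw [e1r, e2r] at hy3
    have h : ⌊u.2.2 - y'.1 * (u.2.1 - y'.2.1)⌋ = y.2.2 :=
      Int.floor_eq_iff.mpr ⟨by linarith [hy3.1], by linarith [hy3.2]⟩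
    have h' : ⌊u.2.2 - y'.1 * (u.2.1 - y'.2.1)⌋ = y'.2.2 :=
      Int.floor_eq_iff.mpr ⟨by linarith [hy3'.1], by linarith [hy3'.2]⟩
    exact h.symm.trans h'
  exact Prod.ext e1 (Prod.ext e2 e3)

/-- Membership in the cell `y·[0,1)³`, as a preimage of the unit cube under `u ↦ y⁻¹u`, in
coordinates. [cite: NaorYoung2018, §2] -/
theorem mem_cell_iff (y : ℤ × ℤ × ℤ) (u : ℝ × ℝ × ℝ) :
    u ∈ (mulR (invR (castR y))) ⁻¹' (Set.Ico (0 : ℝ) 1 ×ˢ (Set.Ico (0 : ℝ) 1 ×ˢ Set.Ico (0 : ℝ) 1)) ↔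
      (0 ≤ u.1 - y.1 ∧ u.1 - y.1 < 1) ∧ (0 ≤ u.2.1 - y.2.1 ∧ u.2.1 - y.2.1 < 1) ∧
        (0 ≤ u.2.2 - y.2.2 - y.1 * (u.2.1 - y.2.1) ∧ u.2.2 - y.2.2 - y.1 * (u.2.1 - y.2.1) < 1) := by
  rw [Set.mem_preimage, mulR_invR_castR_apply]
  simp only [Set.mem_prod, Set.mem_Ico]
  have e : u.2.2 - (y.2.2 : ℝ) + y.1 * y.2.1 - y.1 * u.2.1 = u.2.2 - y.2.2 - y.1 * (u.2.1 - y.2.1) := by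
    ring
  rw [e]

/-- Cells are measurable. [cite: NaorYoung2018, §2] -/
theorem measurableSet_cell (y : ℤ × ℤ × ℤ) :
    MeasurableSet ((mulR (invR (castR y))) ⁻¹'
      (Set.Ico (0 : ℝ) 1 ×ˢ (Set.Ico (0 : ℝ) 1 ×ˢ Set.Ico (0 : ℝ) 1))) :=
  (measurableSet_Ico.prod (measurableSet_Ico.prod measurableSet_Ico)).preimage
    (contDiff_mulR _).continuous.measurable

/-- **Left translations preserve Lebesgue measure** (Haar measure of `ℍ(ℝ)` is `dx dy dz`; the map
`u ↦ y⁻¹u` is a shear followed by a translation — `HeisK.measurePreserving_coord_mul_left`).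
[cite: NaorYoung2018, §2] -/
theorem measurePreserving_mulR_invR_castR (y : ℤ × ℤ × ℤ) :
    MeasurePreserving (mulR (invR (castR y))) (volume : Measure (ℝ × ℝ × ℝ)) volume := by
  have h := HeisK.measurePreserving_coord_mul_left (HeisK.mk (-(y.1 : ℝ)) (-(y.2.1 : ℝ))
    (-(y.2.2 : ℝ) + y.1 * y.2.1))
  have e : (mulR (invR (castR y))) = fun t : ℝ × ℝ × ℝ =>
      ((HeisK.mk (-(y.1 : ℝ)) (-(y.2.1 : ℝ)) (-(y.2.2 : ℝ) + y.1 * y.2.1)).x + t.1,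
        (HeisK.mk (-(y.1 : ℝ)) (-(y.2.1 : ℝ)) (-(y.2.2 : ℝ) + y.1 * y.2.1)).y + t.2.1,
        (HeisK.mk (-(y.1 : ℝ)) (-(y.2.1 : ℝ)) (-(y.2.2 : ℝ) + y.1 * y.2.1)).z +
          (t.2.2 + (HeisK.mk (-(y.1 : ℝ)) (-(y.2.1 : ℝ)) (-(y.2.2 : ℝ) + y.1 * y.2.1)).x * t.2.1)) := by
    funext t
    refine Prod.ext (by simp only [mulR, invR, castR, HeisK.mk_x])
      (Prod.ext (by simp only [mulR, invR, castR, HeisK.mk_y]) ?_)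
    simp only [mulR, invR, castR, HeisK.mk_x, HeisK.mk_z]
    ring
  rw [e]
  exact h

/-- **Cells have unit volume.** [cite: NaorYoung2018, §2] -/
theorem volume_cell (y : ℤ × ℤ × ℤ) :
    volume ((mulR (invR (castR y))) ⁻¹' (Set.Ico (0 : ℝ) 1 ×ˢ (Set.Ico (0 : ℝ) 1 ×ˢ Set.Ico (0 : ℝ) 1))) = 1 := by
  rw [(measurePreserving_mulR_invR_castR y).measure_preimage
    (measurableSet_Ico.prod (measurableSet_Ico.prod measurableSet_Ico)).nullMeasurableSet]
  rw [Measure.volume_eq_prod, Measure.prod_prod, Measure.volume_eq_prod, Measure.prod_prod,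
    Real.volume_Ico]
  norm_num

/-- **The count of separated `y` in any finite set is at most the displacement count**:
`Σ_{y ∈ Y} |𝟙_Ω(yz) − 𝟙_Ω(y)| ≤ dispCount Ω z`. [cite: NaorYoung2018, §3.1 Lemma 3.4] -/
theorem sum_abs_ind_sub_le_dispCount (Ω Y : Finset (ℤ × ℤ × ℤ)) (z : ℤ × ℤ × ℤ) :
    ∑ y ∈ Y, |(if heisMul y z ∈ Ω then (1 : ℝ) else 0) - (if y ∈ Ω then (1 : ℝ) else 0)| ≤
      dispCount Ω z := by
  classical
  have hpt : ∀ y : ℤ × ℤ × ℤ,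
      |(if heisMul y z ∈ Ω then (1 : ℝ) else 0) - (if y ∈ Ω then (1 : ℝ) else 0)| =
        (if y ∈ Ω ∧ heisMul y z ∉ Ω then (1 : ℝ) else 0) +
          (if y ∉ Ω ∧ heisMul y z ∈ Ω then (1 : ℝ) else 0) := by
    intro y
    by_cases h1 : heisMul y z ∈ Ω <;> by_cases h2 : y ∈ Ω <;> simp [h1, h2]
  simp_rw [hpt]
  rw [Finset.sum_add_distrib, Finset.sum_boole, Finset.sum_boole, dispCount, Nat.cast_add]
  refine add_le_add ?_ ?_
  · exact_mod_cast card_le_card fun y hy => by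
      rw [mem_filter] at hy ⊢
      exact ⟨hy.2.1, hy.2.2⟩
  · have h : (Y.filter fun y => y ∉ Ω ∧ heisMul y z ∈ Ω).card ≤
        (Ω.filter fun x => heisMul x (heisInv z) ∉ Ω).card := by
      refine card_le_card_of_injOn (fun y => heisMul y z) (fun y hy => ?_)
        (fun y _ y' _ h => heisMul_left_injective z h)
      rw [mem_coe, mem_filter] at hy
      rw [mem_coe, mem_filter]
      refine ⟨hy.2.2, ?_⟩
      rw [heisMul_heisMul_heisInv]
      exact hy.2.1
    exact_mod_cast h

/-- **The integrated horizontal-gradient bound** ([NY18, (3.7)–(3.9)] / [LN14, gradient control]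
for `f = 𝟙_Ω`, `p = 1`):
`∫_{ℍ(ℝ)} (|XF| + |YF|) dh ≤ M · 30·|𝓑_{30}| · |∂_h Ω|` for `F = Σ_{g∈Ω} χ_g`, `M` a bound for
`|Xχ| + |Yχ|` — integrate the pointwise bound `fderiv_smear_bound` over the cells `y·[0,1)³` (unit
volume, disjoint), and use `Σ_y |𝟙_Ω(yz) − 𝟙_Ω(y)| ≤ dispCount Ω z ≤ 30 |∂_hΩ|` for `z ∈ 𝓑_{30}`
(`sum_dispCount_wordBall_le`). [cite: NaorYoung2018, §3.2 Lemma 3.6] -/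
theorem integral_fderiv_smear_le (Ω : Finset (ℤ × ℤ × ℤ)) {M : ℝ}
    (hM : ∀ w : ℝ × ℝ × ℝ, |fderiv ℝ bump3 w (1, 0, 0)| + |fderiv ℝ bump3 w (0, 1, w.1)| ≤ M) :
    ∫ u : ℝ × ℝ × ℝ, (|fderiv ℝ (smear Ω) u (1, 0, 0)| + |fderiv ℝ (smear Ω) u (0, 1, u.1)|) ≤
      M * (30 * ((wordBall_finite 30).toFinset.card : ℝ) *
        (((Ω ×ˢ ({(1, 0, 0), (-1, 0, 0), (0, 1, 0), (0, -1, 0)} : Finset (ℤ × ℤ × ℤ))).filter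
          fun p => heisMul p.1 p.2 ∉ Ω).card : ℝ)) := by
  classical
  set G : ℝ × ℝ × ℝ → ℝ := fun u =>
    |fderiv ℝ (smear Ω) u (1, 0, 0)| + |fderiv ℝ (smear Ω) u (0, 1, u.1)| with hG
  set B := (wordBall_finite 30).toFinset with hB
  set cell : ℤ × ℤ × ℤ → Set (ℝ × ℝ × ℝ) := fun y =>
    (mulR (invR (castR y))) ⁻¹' (Set.Ico (0 : ℝ) 1 ×ˢ (Set.Ico (0 : ℝ) 1 ×ˢ Set.Ico (0 : ℝ) 1))
    with hcell
  set S : ℤ × ℤ × ℤ → ℝ := fun y => ∑ z ∈ B,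
    |(if heisMul y z ∈ Ω then (1 : ℝ) else 0) - (if y ∈ Ω then (1 : ℝ) else 0)| with hS
  have hM0 : 0 ≤ M := le_trans (by positivity) (hM 0)
  have hS0 : ∀ y, 0 ≤ S y := fun y => Finset.sum_nonneg fun z _ => abs_nonneg _
  -- regularity of `G`
  have hcontF : Continuous (fderiv ℝ (smear Ω)) := (contDiff_smear Ω).continuous_fderiv (by simp)
  have hGc : Continuous G := by
    refine Continuous.add ?_ ?_
    · exact (hcontF.clm_apply continuous_const).abs
    · exact (hcontF.clm_apply (continuous_const.prodMk (continuous_const.prodMk continuous_fst))).abs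
  have hGsupp : HasCompactSupport G := by
    have h := (hasCompactSupport_smear Ω).fderiv (𝕜 := ℝ)
    refine h.mono fun u hu => ?_
    intro h0
    apply hu
    show |fderiv ℝ (smear Ω) u (1, 0, 0)| + |fderiv ℝ (smear Ω) u (0, 1, u.1)| = 0
    rw [h0]
    simp
  have hGint : Integrable G := hGc.integrable_of_hasCompactSupport hGsupp
  have hG0 : ∀ u, 0 ≤ G u := fun u => by positivity
  -- pointwise bound on each cell
  have hGcell : ∀ y u, u ∈ cell y → G u ≤ M * S y := by
    intro y u hu
    rw [hcell, mem_cell_iff] at hu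
    exact fderiv_smear_bound Ω hM u y hu.1 hu.2.1 hu.2.2
  -- the finitely many cells carrying `G`
  set Y₀ : Finset (ℤ × ℤ × ℤ) := (Ω ×ˢ B).image fun p => heisMul p.1 (heisInv p.2) with hY₀
  have hzero : ∀ u, u ∉ (⋃ y ∈ Y₀, cell y) → G u = 0 := by
    intro u hu
    obtain ⟨y, hy1, hy2, hy3⟩ := exists_cell u
    have huy : u ∈ cell y := (mem_cell_iff y u).mpr ⟨hy1, hy2, hy3⟩
    have hyY : y ∉ Y₀ := fun h => hu (Set.mem_biUnion h huy)
    -- every `χ_g`, `g ∈ Ω`, has vanishing derivative at `u`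
    have hvan : ∀ g ∈ Ω, fderiv ℝ (bumpAt g) u = 0 := by
      intro g hg
      apply fderiv_bumpAt_eq_zero
      intro hrel
      apply hyY
      rw [hY₀, Finset.mem_image]
      refine ⟨(g, heisMul (heisInv y) g), Finset.mem_product.mpr ⟨hg, ?_⟩, ?_⟩
      · rw [hB, Set.Finite.mem_toFinset]
        exact heisInv_mul_mem_wordBall_of_rel hy1 hy2 ⟨hy3.1, by linarith [hy3.2]⟩ hrel
      · show heisMul g (heisInv (heisMul (heisInv y) g)) = y
        rw [heisInv_heisMul_eq, heisInv_heisInv, ← heisMul_assoc, heisMul_heisInv, heisMul_zero_left]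
    have hF0 : fderiv ℝ (smear Ω) u = 0 := by
      have h : HasFDerivAt (smear Ω) (∑ g ∈ Ω, fderiv ℝ (bumpAt g) u) u := by
        unfold smear
        exact HasFDerivAt.fun_sum fun g _ =>
          ((contDiff_bumpAt g).differentiable (by simp) _).hasFDerivAt
      rw [h.fderiv]
      exact Finset.sum_eq_zero hvan
    show |fderiv ℝ (smear Ω) u (1, 0, 0)| + |fderiv ℝ (smear Ω) u (0, 1, u.1)| = 0
    rw [hF0]
    simp
  -- integrate cell by cell
  have hdisj : Set.Pairwise (↑Y₀) (Function.onFun Disjoint cell) := by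
    intro y _ y' _ hne
    rw [Function.onFun, Set.disjoint_left]
    intro u hu hu'
    rw [hcell, mem_cell_iff] at hu hu'
    exact hne (cell_unique hu.1 hu.2.1 hu.2.2 hu'.1 hu'.2.1 hu'.2.2)
  have hcellint : ∀ y ∈ Y₀, ∫ u in cell y, G u ≤ M * S y := by
    intro y _
    have hvol : volume (cell y) = 1 := volume_cell y
    have h := norm_setIntegral_le_of_norm_le_const (μ := volume) (s := cell y) (f := G)
      (C := M * S y) (by rw [hvol]; exact ENNReal.one_lt_top) fun u hu => by
        rw [Real.norm_eq_abs, abs_of_nonneg (hG0 u)]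
        exact hGcell y u hu
    rw [measureReal_def, hvol, ENNReal.toReal_one, mul_one, Real.norm_eq_abs] at h
    exact (le_abs_self _).trans h
  calc ∫ u, G u = ∫ u in ⋃ y ∈ Y₀, cell y, G u :=
        (setIntegral_eq_integral_of_forall_compl_eq_zero hzero).symm
    _ = ∑ y ∈ Y₀, ∫ u in cell y, G u :=
        integral_biUnion_finset Y₀ (fun y _ => measurableSet_cell y) hdisj
          (fun y _ => hGint.integrableOn)
    _ ≤ ∑ y ∈ Y₀, M * S y := Finset.sum_le_sum hcellint
    _ = M * ∑ z ∈ B, ∑ y ∈ Y₀,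
          |(if heisMul y z ∈ Ω then (1 : ℝ) else 0) - (if y ∈ Ω then (1 : ℝ) else 0)| := by
        rw [← Finset.mul_sum, hS, Finset.sum_comm]
    _ ≤ M * ∑ z ∈ B, (dispCount Ω z : ℝ) :=
        mul_le_mul_of_nonneg_left (Finset.sum_le_sum fun z _ => sum_abs_ind_sub_le_dispCount Ω Y₀ z) hM0
    _ ≤ M * (30 * ((wordBall_finite 30).toFinset.card : ℝ) *
        (((Ω ×ˢ ({(1, 0, 0), (-1, 0, 0), (0, 1, 0), (0, -1, 0)} : Finset (ℤ × ℤ × ℤ))).filter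
          fun p => heisMul p.1 p.2 ∉ Ω).card : ℝ)) := by
        refine mul_le_mul_of_nonneg_left ?_ hM0
        have h := sum_dispCount_wordBall_le Ω 30
        rw [hB]
        exact_mod_cast h

end Cells

end Literature.Geometry.MetricEmbeddings

end
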